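import Summits.CriticalPhenomena.PercolationContinuityZ3.Theorems.PercNearOneGluingNoHeavyLowerTailQuantitativeHarrisProdBernoulli
import HarnessLib

/-!
# Coordinate sections under a product weight: law of total covariance, cylinder floors, and the AND/OR covariance
# (bookkeeping for the sharp explicit strictness of Harris' inequality, BENCH row M2-R48)

Support file (`--supports stmt-CriticalPhenomena-4575`), prover seat `prim-rate-mine-2` (lane prim-rate, constants-miner (c), BENCH row
M2-R48; `run/shared/lean/prim/prim-rate/prim-rate-mine-2/PROOFS.md` §P48).  No definitions, no named facts, no sorries; standard axioms.

Everything lives on the cube `ι → Bool` with Sahi's finite expectation `ex (prodWeight q)`; sections along a coordinate `a` are written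
`x ↦ f(x^{a→b})` with `Function.update`, so the index type never changes (this is what makes the induction of the next file painless).
* `ex_split_update`, `cov_split_update` — `E h = q_a E h¹ + (1−q_a) E h⁰` and the LAW OF TOTAL COVARIANCE along `a`
  `Cov(f,g) = q_a Cov(f¹,g¹) + (1−q_a) Cov(f⁰,g⁰) + q_a(1−q_a)(E f¹ − E f⁰)(E g¹ − E g⁰)`;
* `cov_section_le` (with the tree's Harris `QuantHarris.cov_nonneg`) — freezing a coordinate at `b` costs the factor `q_a` / `1 − q_a`;
* `eq_of_forall_update_eq`, `section_update_eq`, `pivDiff_update_eq` — functions ignoring updates outside a coordinate set `R`;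
* `cyl_mul_le_ex` — CYLINDER FLOOR: for such `h ≥ 0`, `(Π_{i∈R} q_i^{x_i}(1−q_i)^{1−x_i}) · h(x) ≤ E h`;
* `cov_and_or_eq_prod` — `Cov(1{all open}, 1{some open}) = Π_i q_i(1−q_i)` exactly (the equality case of row M2-R48).
[cite: Harris1960, Lemma 4.1 (p. 16)] [cite: FortuinKasteleynGinibre1971, Prop. 1 (p. 91)]
-/

noncomputable section

namespace Summit.CriticalPhenomena.PercolationContinuityZ3.Theorems

namespace QuantHarris

open Finset Literature.Combinatorics.Sahi2008 SahiSubsetChord SahiCoSingleton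

variable {ι : Type*} [Fintype ι] [DecidableEq ι]

/-! ### Sections along one coordinate, written with `Function.update` (no change of index type) -/

/-- Splitting the expectation along coordinate `a`: `E h = q_a·E[h(x^{a→1})] + (1−q_a)·E[h(x^{a→0})]`. [folklore] -/
theorem ex_split_update (q : ι → ℝ) (a : ι) (h : (ι → Bool) → ℝ) :
    ex (prodWeight q) h
      = q a * ex (prodWeight q) (fun x => h (Function.update x a true))
        + (1 - q a) * ex (prodWeight q) (fun x => h (Function.update x a false)) := by
  rw [ex_eq_hi_lo q a h, ex_eq_hi_lo q a (fun x => h (Function.update x a true)),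
    ex_eq_hi_lo q a (fun x => h (Function.update x a false))]
  simp only [update_hi_true, update_hi_false, update_lo_true, update_lo_false]
  ring

/-- **Law of total covariance along coordinate `a`** (exact, sections via `Function.update`):
`Cov(f,g) = q_a·Cov(f¹,g¹) + (1−q_a)·Cov(f⁰,g⁰) + q_a(1−q_a)·(E f¹ − E f⁰)(E g¹ − E g⁰)`. [cite: Harris1960, Lemma 4.1 (p. 16)] -/
theorem cov_split_update (q : ι → ℝ) (a : ι) (f g : (ι → Bool) → ℝ) :
    ex (prodWeight q) (f * g) - ex (prodWeight q) f * ex (prodWeight q) g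
      = q a * (ex (prodWeight q) ((fun x => f (Function.update x a true)) * fun x => g (Function.update x a true))
              - ex (prodWeight q) (fun x => f (Function.update x a true))
                * ex (prodWeight q) (fun x => g (Function.update x a true)))
        + (1 - q a) * (ex (prodWeight q) ((fun x => f (Function.update x a false)) * fun x => g (Function.update x a false))
              - ex (prodWeight q) (fun x => f (Function.update x a false))
                * ex (prodWeight q) (fun x => g (Function.update x a false)))
        + q a * (1 - q a) *
            ((ex (prodWeight q) (fun x => f (Function.update x a true)) - ex (prodWeight q) (fun x => f (Function.update x a false)))
              * (ex (prodWeight q) (fun x => g (Function.update x a true))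
                  - ex (prodWeight q) (fun x => g (Function.update x a false)))) := by
  have hfg : ex (prodWeight q) (f * g)
      = q a * ex (prodWeight q) ((fun x => f (Function.update x a true)) * fun x => g (Function.update x a true))
        + (1 - q a) * ex (prodWeight q) ((fun x => f (Function.update x a false)) * fun x => g (Function.update x a false)) := by
    rw [ex_split_update q a (f * g)]; rfl
  rw [hfg, ex_split_update q a f, ex_split_update q a g]
  ring

/-- `E[D_a f] = E f¹ − E f⁰`. [folklore] -/
theorem ex_pivDiff_eq_sub (q : ι → ℝ) (a : ι) (f : (ι → Bool) → ℝ) :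
    ex (prodWeight q) (pivDiff a f)
      = ex (prodWeight q) (fun x => f (Function.update x a true)) - ex (prodWeight q) (fun x => f (Function.update x a false)) := by
  simp only [ex, pivDiff, mul_sub, Finset.sum_sub_distrib]

omit [Fintype ι] in
/-- Sections of a monotone function are monotone. [folklore] -/
theorem monotone_comp_update {f : (ι → Bool) → ℝ} (hf : Monotone f) (a : ι) (b : Bool) :
    Monotone (fun x : ι → Bool => f (Function.update x a b)) := by
  intro x y hxy
  apply hf
  intro i
  rcases eq_or_ne i a with rfl | h
  · rw [Function.update_self, Function.update_self]
  · rw [Function.update_of_ne h, Function.update_of_ne h]; exact hxy i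

/-- **Freezing a coordinate costs its weight**: `(q_a if b else 1−q_a) · Cov(f^b, g^b) ≤ Cov(f,g)` (the other section and the influence
term of the law of total covariance are nonnegative by Harris and monotonicity). [cite: Harris1960, Lemma 4.1 (p. 16)] -/
theorem cov_section_le {q : ι → ℝ} (hq : ∀ i, 0 ≤ q i ∧ q i ≤ 1) (a : ι) (b : Bool) {f g : (ι → Bool) → ℝ}
    (hf0 : ∀ x, 0 ≤ f x) (hg0 : ∀ x, 0 ≤ g x) (hf : Monotone f) (hg : Monotone g) :
    (if b then q a else 1 - q a) *
        (ex (prodWeight q) ((fun x => f (Function.update x a b)) * fun x => g (Function.update x a b))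
          - ex (prodWeight q) (fun x => f (Function.update x a b)) * ex (prodWeight q) (fun x => g (Function.update x a b)))
      ≤ ex (prodWeight q) (f * g) - ex (prodWeight q) f * ex (prodWeight q) g := by
  rw [cov_split_update q a f g]
  have h1 := cov_nonneg hq (fun x => hf0 _) (fun x => hg0 _) (monotone_comp_update hf a true) (monotone_comp_update hg a true)
  have h0 := cov_nonneg hq (fun x => hf0 _) (fun x => hg0 _) (monotone_comp_update hf a false)
    (monotone_comp_update hg a false)
  have hw : ∀ x, 0 ≤ prodWeight q x := prodWeight_nonneg hq
  have hΔf : 0 ≤ ex (prodWeight q) (fun x => f (Function.update x a true)) - ex (prodWeight q) (fun x => f (Function.update x a false)) := by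
    rw [← ex_pivDiff_eq_sub]; exact ex_nonneg hw (pivDiff_nonneg hf a)
  have hΔg : 0 ≤ ex (prodWeight q) (fun x => g (Function.update x a true)) - ex (prodWeight q) (fun x => g (Function.update x a false)) := by
    rw [← ex_pivDiff_eq_sub]; exact ex_nonneg hw (pivDiff_nonneg hg a)
  have hqa0 := (hq a).1
  have hqa1 : 0 ≤ 1 - q a := sub_nonneg.2 (hq a).2
  cases b
  · simp only [Bool.false_eq_true, if_false]
    nlinarith [mul_nonneg hqa0 h1, mul_nonneg (mul_nonneg hqa0 hqa1) (mul_nonneg hΔf hΔg)]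
  · simp only [if_true]
    nlinarith [mul_nonneg hqa1 h0, mul_nonneg (mul_nonneg hqa0 hqa1) (mul_nonneg hΔf hΔg)]

/-! ### Functions depending on a set of coordinates; cylinder floors -/

omit [Fintype ι] in
/-- A function unchanged by every update outside `R` depends only on the coordinates in `R`. [folklore] -/
theorem eq_of_forall_update_eq [Fintype ι] {R : Finset ι} {h : (ι → Bool) → ℝ}
    (hR : ∀ x a b, a ∉ R → h (Function.update x a b) = h x) {x y : ι → Bool} (hxy : ∀ i ∈ R, x i = y i) :
    h y = h x := by
  have key : ∀ T : Finset ι, (∀ j ∈ T, j ∉ R) → h (T.piecewise y x) = h x := by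
    intro T
    induction T using Finset.induction_on with
    | empty => intro _; rw [Finset.piecewise_empty]
    | @insert j T hjT ih =>
      intro hT
      rw [Finset.piecewise_insert, hR _ j _ (hT j (Finset.mem_insert_self j T))]
      exact ih fun j' hj' => hT j' (Finset.mem_insert_of_mem hj')
  have hT : ∀ j ∈ (univ : Finset ι).filter (fun j => j ∉ R), j ∉ R := fun j hj => (Finset.mem_filter.1 hj).2
  have hpw : ((univ : Finset ι).filter (fun j => j ∉ R)).piecewise y x = y := by
    funext i
    by_cases hi : i ∈ R
    · rw [Finset.piecewise_eq_of_notMem _ _ _ (by simp [hi])]; exact hxy i hi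
    · rw [Finset.piecewise_eq_of_mem _ _ _ (by simp [hi])]
  rw [← hpw]
  exact key _ hT

omit [Fintype ι] in
/-- Sections inherit coordinate-independence: if `h` ignores updates outside `S`, then `x ↦ h(x^{a→b})` ignores updates outside any `T`
with `T ∪ {a} ⊇ S`. [folklore] -/
theorem section_update_eq {S T : Finset ι} {h : (ι → Bool) → ℝ} (hS : ∀ x a' b', a' ∉ S → h (Function.update x a' b') = h x)
    (a : ι) (b : Bool) (hT : ∀ a', a' ∉ T → a' ≠ a → a' ∉ S) :
    ∀ x a' b', a' ∉ T → (fun y => h (Function.update y a b)) (Function.update x a' b') = (fun y => h (Function.update y a b)) x := by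
  intro x a' b' ha'
  simp only
  rcases eq_or_ne a' a with rfl | hne
  · rw [Function.update_idem]
  · rw [Function.update_comm hne, hS _ a' b' (hT a' ha' hne)]

omit [Fintype ι] in
/-- The pivotal increment at `e` of a function ignoring updates outside `insert e S` ignores updates outside `S`. [folklore] -/
theorem pivDiff_update_eq {S : Finset ι} {f : (ι → Bool) → ℝ} (e : ι)
    (hS : ∀ x a' b', a' ∉ insert e S → f (Function.update x a' b') = f x) :
    ∀ x a' b', a' ∉ S → pivDiff e f (Function.update x a' b') = pivDiff e f x := by
  intro x a' b' ha'
  simp only [pivDiff]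
  rcases eq_or_ne a' e with rfl | hne
  · rw [Function.update_idem, Function.update_idem]
  · have h' : a' ∉ insert e S := fun h => (Finset.mem_insert.1 h).elim hne ha'
    rw [Function.update_comm hne, hS _ a' b' h', Function.update_comm hne, hS _ a' b' h']

/-- **Cylinder floor**: if `h ≥ 0` ignores every update outside `R`, then for every configuration `x`
`(Π_{i∈R} (q_i if x_i else 1−q_i)) · h(x) ≤ E h` (the cylinder through `x` over `R` has exactly that mass and `h` is constant on it).
[folklore] -/
theorem cyl_mul_le_ex {q : ι → ℝ} (hq : ∀ i, 0 ≤ q i ∧ q i ≤ 1) (R : Finset ι) :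
    ∀ (h : (ι → Bool) → ℝ), (∀ x, 0 ≤ h x) → (∀ x a b, a ∉ R → h (Function.update x a b) = h x) →
      ∀ x : ι → Bool, (∏ i ∈ R, (if x i then q i else 1 - q i)) * h x ≤ ex (prodWeight q) h := by
  induction R using Finset.induction_on with
  | empty =>
    intro h _ hR x
    rw [Finset.prod_empty, one_mul]
    have hconst : h = fun _ => h x :=
      funext fun y => eq_of_forall_update_eq hR (fun i hi => absurd hi (Finset.notMem_empty i))
    have hc : ex (prodWeight q) h = h x := by
      rw [hconst]
      exact ex_const (μ := prodWeight q) (sum_coinWeight q) (h x)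
    exact hc.symm.le
  | @insert a R haR ih =>
    intro h h0 hR x
    have hw : ∀ y, 0 ≤ prodWeight q y := prodWeight_nonneg hq
    have hsec : ∀ b : Bool, ∀ y a' b', a' ∉ R →
        (fun y => h (Function.update y a b)) (Function.update y a' b') = (fun y => h (Function.update y a b)) y := fun b =>
      section_update_eq hR a b fun a' ha' hne => by
        rw [Finset.mem_insert]; exact fun h' => h'.elim hne ha'
    rw [Finset.prod_insert haR, ex_split_update q a h]
    have e1 : (∏ i ∈ R, (if x i then q i else 1 - q i)) * h (Function.update x a true)
        ≤ ex (prodWeight q) (fun y => h (Function.update y a true)) :=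
      ih (fun y => h (Function.update y a true)) (fun y => h0 _) (hsec true) x
    have e0 : (∏ i ∈ R, (if x i then q i else 1 - q i)) * h (Function.update x a false)
        ≤ ex (prodWeight q) (fun y => h (Function.update y a false)) :=
      ih (fun y => h (Function.update y a false)) (fun y => h0 _) (hsec false) x
    have n1 : 0 ≤ ex (prodWeight q) (fun y => h (Function.update y a true)) := ex_nonneg hw fun y => h0 _
    have n0 : 0 ≤ ex (prodWeight q) (fun y => h (Function.update y a false)) := ex_nonneg hw fun y => h0 _
    have hqa0 := (hq a).1
    have hqa1 : 0 ≤ 1 - q a := sub_nonneg.2 (hq a).2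
    cases hxa : x a
    · have hx0 : Function.update x a false = x := by rw [← hxa, Function.update_eq_self]
      rw [hx0] at e0
      simp only [Bool.false_eq_true, if_false]
      nlinarith [mul_le_mul_of_nonneg_left e0 hqa1, mul_nonneg hqa0 n1]
    · have hx1 : Function.update x a true = x := by rw [← hxa, Function.update_eq_self]
      rw [hx1] at e1
      simp only [if_true]
      nlinarith [mul_le_mul_of_nonneg_left e1 hqa0, mul_nonneg hqa1 n0]


/-! ### Sharpness: AND / OR attain the floor -/

omit [DecidableEq ι] in
/-- Flipping every coordinate turns the weight `1 − q` into the weight `q`. [folklore] -/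
theorem prodWeight_compl_not (q : ι → ℝ) (x : ι → Bool) :
    prodWeight (fun i => 1 - q i) (fun i => !x i) = prodWeight q x := by
  unfold prodWeight
  refine Finset.prod_congr rfl fun i _ => ?_
  cases h : x i <;> simp [h]

/-- `E[1{every coordinate closed}] = Π_i (1 − q_i)`. [folklore] -/
theorem ex_indicator_forall_false (q : ι → ℝ) :
    ex (prodWeight q) (fun x => if (∀ i, x i = false) then (1 : ℝ) else 0) = ∏ i, (1 - q i) := by
  have h := sum_coinWeight_forall (fun i => 1 - q i) (univ : Finset ι)
  unfold ex
  rw [← h]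
  refine Fintype.sum_bijective (fun x : ι → Bool => fun i => !x i)
    (Function.Involutive.bijective fun x => funext fun i => by simp) _ _ fun x => ?_
  show prodWeight q x * (if (∀ i, x i = false) then (1 : ℝ) else 0)
    = if (∀ i ∈ (univ : Finset ι), (!x i) = true) then coinWeight (fun i => 1 - q i) (fun i => !x i) else 0
  by_cases hx : ∀ i, x i = false
  · have hx' : ∀ i ∈ (univ : Finset ι), (!x i) = true := fun i _ => by rw [hx i]; rfl
    rw [if_pos hx, if_pos hx', mul_one]
    exact (prodWeight_compl_not q x).symm
  · have hx' : ¬ ∀ i ∈ (univ : Finset ι), (!x i) = true := fun h' => hx fun i => by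
      have := h' i (Finset.mem_univ i)
      cases hxi : x i
      · rfl
      · rw [hxi] at this; exact absurd this Bool.false_ne_true
    rw [if_neg hx, if_neg hx', mul_zero]

/-- **The floor is attained: AND against OR.**  On a nonempty cube, for `f = 1{every coordinate open}` and `g = 1{some coordinate open}`
(`D_e f(1) = D_e g(0) = 1` for every `e`): `E(fg) − E f·E g = Π_i q_i(1−q_i)` — equality in `cov_ge_jumps_mul_prod` / `cov_ge_twoAtom`
(witnesses `η₁ = 1`, `η₂ = 0`) at EVERY weight vector. [this file] -/
theorem cov_and_or_eq_prod [Nonempty ι] (q : ι → ℝ) :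
    ex (prodWeight q) ((fun x : ι → Bool => if (∀ i, x i = true) then (1 : ℝ) else 0) *
          fun x => if (∃ i, x i = true) then (1 : ℝ) else 0)
      - ex (prodWeight q) (fun x : ι → Bool => if (∀ i, x i = true) then (1 : ℝ) else 0)
        * ex (prodWeight q) (fun x => if (∃ i, x i = true) then (1 : ℝ) else 0)
      = ∏ i, q i * (1 - q i) := by
  -- `E[AND] = Π q`
  have hAND : ex (prodWeight q) (fun x : ι → Bool => if (∀ i, x i = true) then (1 : ℝ) else 0) = ∏ i, q i := by
    have h := sum_coinWeight_forall q (univ : Finset ι)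
    unfold ex
    rw [← h]
    refine Finset.sum_congr rfl fun x _ => ?_
    rw [mul_ite, mul_one, mul_zero]
    by_cases hx : ∀ i, x i = true
    · rw [if_pos hx, if_pos (fun i _ => hx i)]; rfl
    · rw [if_neg hx, if_neg (fun h' => hx fun i => h' i (Finset.mem_univ i))]
  -- `AND · OR = AND`
  have hmul : ((fun x : ι → Bool => if (∀ i, x i = true) then (1 : ℝ) else 0) * fun x => if (∃ i, x i = true) then (1 : ℝ) else 0)
      = fun x : ι → Bool => if (∀ i, x i = true) then (1 : ℝ) else 0 := by
    funext x
    simp only [Pi.mul_apply]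
    by_cases hx : ∀ i, x i = true
    · obtain ⟨i⟩ := ‹Nonempty ι›
      rw [if_pos hx, if_pos ⟨i, hx i⟩, mul_one]
    · rw [if_neg hx, zero_mul]
  -- `E[OR] = 1 − Π (1 − q)`
  have hOR : ex (prodWeight q) (fun x : ι → Bool => if (∃ i, x i = true) then (1 : ℝ) else 0) = 1 - ∏ i, (1 - q i) := by
    have hsplit : (fun x : ι → Bool => if (∃ i, x i = true) then (1 : ℝ) else 0)
        = fun x => 1 - (if (∀ i, x i = false) then (1 : ℝ) else 0) := by
      funext x
      by_cases hx : ∃ i, x i = true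
      · obtain ⟨i, hi⟩ := hx
        rw [if_pos ⟨i, hi⟩, if_neg (fun h' => by rw [h' i] at hi; exact Bool.false_ne_true hi)]; ring
      · have hall : ∀ i, x i = false := fun i => by
          cases h' : x i
          · rfl
          · exact absurd ⟨i, h'⟩ hx
        rw [if_neg hx, if_pos hall]; ring
    rw [hsplit]
    have hNOR := ex_indicator_forall_false q
    have h1 : ∑ x : ι → Bool, prodWeight q x = 1 := sum_coinWeight q
    unfold ex at hNOR ⊢
    simp only [mul_sub, mul_one, Finset.sum_sub_distrib]
    rw [hNOR, h1]
  rw [hmul, hAND, hOR, Finset.prod_mul_distrib]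
  ring


end QuantHarris

end Summit.CriticalPhenomena.PercolationContinuityZ3.Theorems

end
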